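import Summits.ResolutionOfSingularities.ResolutionOfSingularities.Theorems.PurelyInseparableDim4AtlasMemberBasics
import Summits.ResolutionOfSingularities.ResolutionOfSingularities.Theorems.PurelyInseparableDim4ChartAtlasShear
import Summits.ResolutionOfSingularities.ResolutionOfSingularities.Theorems.PurelyInseparableDim4ChartTransfer
import Literature.AlgebraicGeometry.Resolution.BlowupsEquivariant
import HarnessLib

/-!
# Purely inseparable four-folds: a READING OF AN ATLAS MEMBER SURVIVES A CENTRE-PRESERVING SHEAR of its coordinates
# (brick S3 (c) v4, tranche 2 «sheared escaping children», brick G1; cell `res-dim4-pi`)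

[OURS · counted 0] (D-0157 DOOR 2; host item stmt-ResolutionOfSingularities-16155, helper). Nothing here proves resolution of
singularities in dimension ≥ 4 / characteristic `p`. Finding E-V4-4 (`res-dim4-typ-3/S3c-V4-ATLAS-MEMBERS-DESIGN.md` §16): a
SHEARED escaping entry at a reading `(s, T, X, D)` of an atlas member is the tranche-1 LINEAR entry at the SHEARED reading — same
member `V(z, x_T)`, same owned sets, state `clean(τ F)` — for a `K`-automorphism `τ` of `K[x₁..x₄]` preserving the ideal `(x_T)`.
This file is the reading change itself, for ANY such `τ`: if a zigzag chart `X′ ←φ— Y —ψ→ 𝔸⁵` reads an ideal sheaf `I` as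
`(z^p + F)·𝒪`, an ideal sheaf `J` as `𝓘Λ(T)` and sees `V(z, x_T)`, with `p ≤ ord_T F` (`p` here only `≥ 1` matters for the
centre), then composing `ψ` with the automorphism `Spec Θ` of `𝔸⁵` lifting `τ⁻¹` and the cleaning of `τ F` (typ-2's
`ChartDictionary.exists_algEquiv_shear_lift`) gives a zigzag `X′ ←φ— Y —ψ′→ 𝔸⁵` reading `I` as `(z^p + clean(τ F))·𝒪`, `J` still as
`𝓘Λ(T)`, still seeing `V(z, x_T)`; every translated hyperplane `V(x_i + c)` with `τ x_i = x_i` reads the same through `ψ′` as through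
`ψ`, and every owned set `ownedSetZ T X` whose deferral indices are fixed by `τ` has the same `ψ′`- and `ψ`-preimage. The one
algebraic point: the cleaning polynomial lies in `(x_T)` (because `(x_T)` is prime and `clean(τF) − τF` is a `p`-th power in it), so
`Θ` preserves `(z, x_T)`.

* §1 `mem_span_X_image_of_one_le_ordAlong`, `deletePthPowers_mem_span_X_image`, `exists_clean_shear_hyp` (the lift `Θ` with
  `Θ(z^p + clean(τF)) = z^p + F`, `Θ(z, x_T) = (z, x_T)`); §2 `specMap_preimage_CΛ_eq`, **`zigzag_shear_reading`** (G1).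

AI-produced formalisation, weaker than expert review. bears_on: LADDER-RESOLUTION:D157-DOOR2 (res-dim4-pi · S3 (c) v4 tranche 2 G1).
-/

set_option linter.dupNamespace false -- D-0017: single-problem summit path `Summit.<S>.<S>.…` by design

noncomputable section

open MvPolynomial Finset CategoryTheory AlgebraicGeometry Opposite TopologicalSpace
open AlgebraicGeometry.Scheme.IdealSheafData (ofIdealTop vanishingIdeal)

namespace Summit.ResolutionOfSingularities.ResolutionOfSingularities.Theorems.PIDim4

open Literature.AlgebraicGeometry.Resolution
open Literature.AlgebraicGeometry.Resolution.Hauser2010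
open Literature.AlgebraicGeometry.Resolution.AffinePointBlowup (P A γ coord Wtop ξ)

namespace Equimultiple

/-! ## §1 Algebra: the cleaning polynomial of a sheared state lies in `(x_T)` -/

section ShearAlgebra

variable {K : Type} [Field K] {p : ℕ} [hp : Fact p.Prime] [CharP K p]

omit hp [CharP K p] in
/-- A polynomial of positive order along `(x_T)` lies in the ideal `(x_i : i ∈ T)`. [cite: HauserPerlega2019PRIMS, §2 (ord_P)] -/
theorem mem_span_X_image_of_one_le_ordAlong {T : Finset (Fin 4)} {F : MvPolynomial (Fin 4) K}
    (h : (1 : ℕ∞) ≤ CentreBlowup.ordAlong T F) : F ∈ Ideal.span (X '' (T : Set (Fin 4)) : Set (MvPolynomial (Fin 4) K)) := by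
  rw [MvPolynomial.mem_ideal_span_X_image]
  intro d hd
  have h1 := (CentreBlowup.le_ordAlong_iff.mp h) d hd
  have h2 : CentreBlowup.degIn T d ≠ 0 := by
    intro h0
    rw [h0, Nat.cast_zero] at h1
    exact absurd h1 (by norm_num)
  by_contra hall
  push Not at hall
  exact h2 (CentreBlowup.degIn_eq_zero_iff.mpr fun i hi => hall i hi)

omit hp [CharP K p] in
/-- Deleting `p`-th power monomials keeps membership in a variable ideal `(x_i : i ∈ T)`. [folklore] -/
theorem deletePthPowers_mem_span_X_image {T : Finset (Fin 4)} {G : MvPolynomial (Fin 4) K}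
    (h : G ∈ Ideal.span (X '' (T : Set (Fin 4)) : Set (MvPolynomial (Fin 4) K))) :
    deletePthPowers p G ∈ Ideal.span (X '' (T : Set (Fin 4)) : Set (MvPolynomial (Fin 4) K)) := by
  classical
  rw [MvPolynomial.mem_ideal_span_X_image] at h ⊢
  intro d hd
  refine h d ?_
  rw [MvPolynomial.mem_support_iff] at hd ⊢
  rw [coeff_deletePthPowers] at hd
  by_cases hP : IsPthPowerExponent p d
  · rw [if_pos hP] at hd; exact absurd rfl hd
  · rw [if_neg hP] at hd; exact hd

/-- **The lift of a centre-preserving shear with its cleaning.** For a `K`-automorphism `τ` of `K[x₁..x₄]` mapping `(x_T)` into itself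
in both directions and `F` of order `≥ 1` along `(x_T)`, over a perfect field: an automorphism `Θ` of `K[z, x]` with `Θ xᵢ = τ⁻¹ xᵢ`,
`Θ z = z + g(x)` with `g ∈ (x_T)`, `Θ (z^p + clean(τ F)) = z^p + F`, and `Θ` maps the ideal `(z, x_T)` onto itself.
[cite: Hauser2010, §G (cleaning)] [cite: HauserPerlega2019PRIMS, §2] -/
theorem exists_clean_shear_hyp [PerfectRing K p] {T : Finset (Fin 4)} {F : MvPolynomial (Fin 4) K}
    (hF : (1 : ℕ∞) ≤ CentreBlowup.ordAlong T F) (τ : MvPolynomial (Fin 4) K ≃ₐ[K] MvPolynomial (Fin 4) K)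
    (hτ : ∀ i ∈ T, τ (X i) ∈ Ideal.span (X '' (T : Set (Fin 4)) : Set (MvPolynomial (Fin 4) K)))
    (hτ' : ∀ i ∈ T, τ.symm (X i) ∈ Ideal.span (X '' (T : Set (Fin 4)) : Set (MvPolynomial (Fin 4) K))) :
    ∃ (Θ : A 4 K ≃ₐ[K] A 4 K) (g : MvPolynomial (Fin 4) K),
      g ∈ Ideal.span (X '' (T : Set (Fin 4)) : Set (MvPolynomial (Fin 4) K)) ∧
      Θ (X 0) = X 0 + rename Fin.succ g ∧ (∀ i : Fin 4, Θ (X i.succ) = rename Fin.succ (τ.symm (X i))) ∧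
      Θ (hyp p (deletePthPowers p (τ F))) = hyp p F ∧
      (∀ i ∈ insert (0 : Fin (4 + 1)) (Fin.succ '' (T : Set (Fin 4))),
        Θ (X i) ∈ Ideal.span (X '' (insert (0 : Fin (4 + 1)) (Fin.succ '' (T : Set (Fin 4)))) : Set (A 4 K))) ∧
      (∀ i ∈ insert (0 : Fin (4 + 1)) (Fin.succ '' (T : Set (Fin 4))),
        Θ.symm (X i) ∈ Ideal.span (X '' (insert (0 : Fin (4 + 1)) (Fin.succ '' (T : Set (Fin 4)))) : Set (A 4 K))) := by
  classical
  set 𝔭 : Ideal (MvPolynomial (Fin 4) K) := Ideal.span (X '' (T : Set (Fin 4))) with h𝔭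
  set Λ : Set (Fin (4 + 1)) := insert (0 : Fin (4 + 1)) (Fin.succ '' (T : Set (Fin 4))) with hΛ
  set J : Ideal (A 4 K) := Ideal.span (X '' Λ) with hJ
  haveI h𝔭prime : 𝔭.IsPrime := Literature.RingTheory.MvPolynomial.isPrime_span_X_image _
  -- `τ` and `τ⁻¹` map `𝔭` into itself
  have hmapτ : ∀ G ∈ 𝔭, τ G ∈ 𝔭 := by
    intro G hG
    have h1 : Ideal.map (τ : MvPolynomial (Fin 4) K →+* MvPolynomial (Fin 4) K) 𝔭 ≤ 𝔭 := by
      rw [h𝔭, Ideal.map_span, Ideal.span_le]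
      rintro _ ⟨_, ⟨i, hi, rfl⟩, rfl⟩
      exact hτ i hi
    exact h1 (Ideal.mem_map_of_mem _ hG)
  have hmapτ' : ∀ G ∈ 𝔭, τ.symm G ∈ 𝔭 := by
    intro G hG
    have h1 : Ideal.map (τ.symm : MvPolynomial (Fin 4) K →+* MvPolynomial (Fin 4) K) 𝔭 ≤ 𝔭 := by
      rw [h𝔭, Ideal.map_span, Ideal.span_le]
      rintro _ ⟨_, ⟨i, hi, rfl⟩, rfl⟩
      exact hτ' i hi
    exact h1 (Ideal.mem_map_of_mem _ hG)
  -- the cleaning polynomial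
  obtain ⟨h, hh⟩ := exists_add_pow_eq_deletePthPowers (p := p) 1 (τ F)
  rw [pow_one] at hh
  have hFp : F ∈ 𝔭 := mem_span_X_image_of_one_le_ordAlong hF
  have hτF : τ F ∈ 𝔭 := hmapτ F hFp
  have hclean : deletePthPowers p (τ F) ∈ 𝔭 := deletePthPowers_mem_span_X_image hτF
  have hhp : h ^ p ∈ 𝔭 := by
    have : h ^ p = deletePthPowers p (τ F) - τ F := by rw [← hh]; ring
    rw [this]
    exact 𝔭.sub_mem hclean hτF
  have hh𝔭 : h ∈ 𝔭 := h𝔭prime.mem_of_pow_mem p hhp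
  set g : MvPolynomial (Fin 4) K := -τ.symm h with hg
  have hg𝔭 : g ∈ 𝔭 := 𝔭.neg_mem (hmapτ' h hh𝔭)
  obtain ⟨Θ, hΘ0, hΘs⟩ := ChartDictionary.exists_algEquiv_shear_lift (K := K) τ.symm g
  -- `Θ ∘ rename = rename ∘ τ⁻¹`
  have hce : (Θ : A 4 K →ₐ[K] A 4 K).comp (rename Fin.succ) =
      (rename Fin.succ).comp (τ.symm : MvPolynomial (Fin 4) K →ₐ[K] MvPolynomial (Fin 4) K) := by
    refine MvPolynomial.algHom_ext fun k => ?_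
    simp only [AlgHom.comp_apply, rename_X, AlgEquiv.coe_toAlgHom, hΘs k]
  have he : ∀ G : MvPolynomial (Fin 4) K, Θ (rename Fin.succ G) = rename Fin.succ (τ.symm G) := fun G =>
    congrArg (fun f : MvPolynomial (Fin 4) K →ₐ[K] A 4 K => f G) hce
  -- membership of renamed elements of `𝔭` in `J`
  have hrename : ∀ G ∈ 𝔭, rename Fin.succ G ∈ J := by
    intro G hG
    have h1 : Ideal.map ((rename (Fin.succ : Fin 4 → Fin (4 + 1)) :
        MvPolynomial (Fin 4) K →ₐ[K] A 4 K).toRingHom) 𝔭 ≤ J := by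
      rw [h𝔭, Ideal.map_span, Ideal.span_le]
      rintro _ ⟨_, ⟨i, hi, rfl⟩, rfl⟩
      show rename Fin.succ (X i) ∈ J
      rw [rename_X]
      exact Ideal.subset_span ⟨i.succ, Set.mem_insert_of_mem _ ⟨i, hi, rfl⟩, rfl⟩
    exact h1 (Ideal.mem_map_of_mem _ hG)
  refine ⟨Θ, g, hg𝔭, hΘ0, hΘs, ?_, ?_, ?_⟩
  · -- the hypersurface: `Θ(z^p + clean(τF)) = (z − τ⁻¹h)^p + F + (τ⁻¹h)^p = z^p + F`
    have h1 : τ.symm (deletePthPowers p (τ F)) = F + τ.symm h ^ p := by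
      rw [← hh, map_add, map_pow, AlgEquiv.symm_apply_apply]
    rw [hyp, hyp, map_add, map_pow, hΘ0, he, h1, map_add, map_pow, hg, map_neg, ← sub_eq_add_neg, sub_pow_char]
    ring
  · -- `Θ` maps the generators of `J` into `J`
    intro i hi
    rcases Set.mem_insert_iff.mp hi with rfl | ⟨k, hk, rfl⟩
    · rw [hΘ0]
      exact J.add_mem (Ideal.subset_span ⟨0, Set.mem_insert _ _, rfl⟩) (hrename g hg𝔭)
    · rw [hΘs k]
      exact hrename _ (hmapτ' _ (Ideal.subset_span ⟨k, hk, rfl⟩))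
  · -- `Θ⁻¹` maps the generators of `J` into `J`
    have he' : ∀ G : MvPolynomial (Fin 4) K, Θ.symm (rename Fin.succ G) = rename Fin.succ (τ G) := fun G => by
      rw [AlgEquiv.symm_apply_eq, he, AlgEquiv.symm_apply_apply]
    have hΘ0' : Θ.symm (X 0) = X 0 - rename Fin.succ (τ g) := by
      rw [AlgEquiv.symm_apply_eq, map_sub, hΘ0, he, AlgEquiv.symm_apply_apply]; ring
    intro i hi
    rcases Set.mem_insert_iff.mp hi with rfl | ⟨k, hk, rfl⟩
    · rw [hΘ0']
      exact J.sub_mem (Ideal.subset_span ⟨0, Set.mem_insert _ _, rfl⟩) (hrename _ (hmapτ g hg𝔭))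
    · have hXk : (X k.succ : A 4 K) = rename Fin.succ (X k) := (rename_X _ _).symm
      rw [hXk, he' (X k)]
      exact hrename _ (hmapτ _ (Ideal.subset_span ⟨k, hk, rfl⟩))

end ShearAlgebra

/-! ## §2 The reading change -/

section ShearReading

variable {K : Type} [Field K] {p : ℕ} [hp : Fact p.Prime] [CharP K p]

omit hp [CharP K p] in
/-- An automorphism `Spec Θ` of `𝔸⁵` with `Θ (z, x_T) = (z, x_T)` (both directions) maps `V(z, x_T)` onto itself.
[cite: AtiyahMacdonald1969, Ch. 1 Ex. 21] -/
theorem specMap_preimage_CΛ_eq {T : Finset (Fin 4)} (Θ : A 4 K ≃ₐ[K] A 4 K)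
    (hΘ : ∀ i ∈ insert (0 : Fin (4 + 1)) (Fin.succ '' (T : Set (Fin 4))),
      Θ (X i) ∈ Ideal.span (X '' (insert (0 : Fin (4 + 1)) (Fin.succ '' (T : Set (Fin 4)))) : Set (A 4 K)))
    (hΘ' : ∀ i ∈ insert (0 : Fin (4 + 1)) (Fin.succ '' (T : Set (Fin 4))),
      Θ.symm (X i) ∈ Ideal.span (X '' (insert (0 : Fin (4 + 1)) (Fin.succ '' (T : Set (Fin 4)))) : Set (A 4 K))) :
    Spec.map (CommRingCat.ofHom (Θ : A 4 K →+* A 4 K)) ⁻¹'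
        (AffineCoordBlowup.CΛ 4 K (insert 0 (Fin.succ '' (T : Set (Fin 4)))) : Set (P 4 K)) =
      (AffineCoordBlowup.CΛ 4 K (insert 0 (Fin.succ '' (T : Set (Fin 4)))) : Set (P 4 K)) := by
  set Λ : Set (Fin (4 + 1)) := insert (0 : Fin (4 + 1)) (Fin.succ '' (T : Set (Fin 4))) with hΛ
  have key : ∀ x : P 4 K, (∀ i ∈ Λ, (X i : A 4 K) ∈ x.asIdeal) ↔ Ideal.span (X '' Λ) ≤ x.asIdeal := fun x => by
    rw [Ideal.span_le, Set.image_subset_iff]; rfl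
  ext x
  rw [Set.mem_preimage, SetLike.mem_coe, SetLike.mem_coe, AffineCoordBlowup.mem_CΛ_iff', AffineCoordBlowup.mem_CΛ_iff',
    Spec.map_apply]
  simp only [PrimeSpectrum.comap_asIdeal, Ideal.mem_comap, CommRingCat.hom_ofHom, RingHom.coe_coe]
  constructor
  · intro h i hi
    -- `X i = Θ (Θ⁻¹ (X i))` and `Θ⁻¹ (X i) ∈ (X_Λ)`, whose `Θ`-image lies in `𝔭_x`
    have h1 : Ideal.map (Θ : A 4 K →+* A 4 K) (Ideal.span (X '' Λ)) ≤ x.asIdeal := by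
      rw [Ideal.map_span, Ideal.span_le]
      rintro _ ⟨_, ⟨k, hk, rfl⟩, rfl⟩
      exact h k hk
    have h2 := h1 (Ideal.mem_map_of_mem (Θ : A 4 K →+* A 4 K) (hΘ' i hi))
    rw [RingHom.coe_coe, AlgEquiv.apply_symm_apply] at h2
    exact h2
  · intro h i hi
    exact (key x).mp h (hΘ i hi)

/-- **G1 — A READING SURVIVES A CENTRE-PRESERVING SHEAR.** See the module docstring. [cite: Hauser2010, §G (coordinate changes
and cleaning)] [cite: BierstoneGrigorievMilmanWlodarczyk2011, Def. 3.1.3 (2), (4)] -/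
theorem zigzag_shear_reading [IsAlgClosed K] {X' Y : Scheme.{0}} (φ : Y ⟶ X') (ψ : Y ⟶ P 4 K) [IsOpenImmersion φ]
    [IsOpenImmersion ψ] (I J : X'.IdealSheafData) {T : Finset (Fin 4)} {F : MvPolynomial (Fin 4) K}
    (hM : I.comap φ = (hypSheaf p F).comap ψ)
    (hZ : J.comap φ = (AffineCoordBlowup.𝓘Λ 4 K (insert 0 (Fin.succ '' (T : Set (Fin 4))))).comap ψ)
    (hsee : (AffineCoordBlowup.CΛ 4 K (insert 0 (Fin.succ '' (T : Set (Fin 4)))) : Set (P 4 K)) ⊆ Set.range ψ)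
    (hF : (1 : ℕ∞) ≤ CentreBlowup.ordAlong T F) (τ : MvPolynomial (Fin 4) K ≃ₐ[K] MvPolynomial (Fin 4) K)
    (hτ : ∀ i ∈ T, τ (X i) ∈ Ideal.span (X '' (T : Set (Fin 4)) : Set (MvPolynomial (Fin 4) K)))
    (hτ' : ∀ i ∈ T, τ.symm (X i) ∈ Ideal.span (X '' (T : Set (Fin 4)) : Set (MvPolynomial (Fin 4) K))) :
    ∃ (ψ' : Y ⟶ P 4 K) (_ : IsOpenImmersion ψ'),
      I.comap φ = (hypSheaf p (deletePthPowers p (τ F))).comap ψ' ∧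
      J.comap φ = (AffineCoordBlowup.𝓘Λ 4 K (insert 0 (Fin.succ '' (T : Set (Fin 4))))).comap ψ' ∧
      (AffineCoordBlowup.CΛ 4 K (insert 0 (Fin.succ '' (T : Set (Fin 4)))) : Set (P 4 K)) ⊆ Set.range ψ' ∧
      (∀ (i : Fin 4) (c : K), τ (X i) = X i → ∀ D : X'.IdealSheafData,
        D.comap φ = (ofIdealTop (Ideal.span {(γ 4 K).symm (X i.succ + C c)})).comap ψ →
        D.comap φ = (ofIdealTop (Ideal.span {(γ 4 K).symm (X i.succ + C c)})).comap ψ') ∧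
      (∀ Xs : Finset (Fin 4 × K), (∀ iv ∈ Xs, τ (X iv.1) = X iv.1) → ψ' ⁻¹' ownedSetZ T Xs = ψ ⁻¹' ownedSetZ T Xs) := by
  classical
  haveI : PerfectRing K p := PerfectRing.ofSurjective K p fun x => IsAlgClosed.exists_pow_nat_eq x hp.out.pos
  obtain ⟨Θ, g, -, -, hΘs, hhyp, hΘJ, hΘJ'⟩ := exists_clean_shear_hyp (p := p) hF τ hτ hτ'
  haveI hiso : IsIso (CommRingCat.ofHom (Θ : A 4 K →+* A 4 K)) := (inferInstance : IsIso Θ.toRingEquiv.toCommRingCatIso.hom)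
  set gΘ : P 4 K ⟶ P 4 K := Spec.map (CommRingCat.ofHom (Θ : A 4 K →+* A 4 K)) with hgΘ
  haveI : IsIso gΘ := inferInstance
  have hpre : gΘ ⁻¹' (AffineCoordBlowup.CΛ 4 K (insert 0 (Fin.succ '' (T : Set (Fin 4)))) : Set (P 4 K)) =
      (AffineCoordBlowup.CΛ 4 K (insert 0 (Fin.succ '' (T : Set (Fin 4)))) : Set (P 4 K)) :=
    specMap_preimage_CΛ_eq Θ hΘJ hΘJ'
  -- letters fixed by `τ` are fixed by `Θ`
  have hfix : ∀ (i : Fin 4) (c : K), τ (X i) = X i → Θ (X i.succ + C c) = X i.succ + C c := by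
    intro i c hi
    have h1 : τ.symm (X i) = X i := by rw [AlgEquiv.symm_apply_eq, hi]
    have hC : Θ (C c) = C c := Θ.commutes c
    rw [map_add, hΘs i, h1, rename_X, hC]
  refine ⟨ψ ≫ gΘ, inferInstance, ?_, ?_, ?_, fun i c hi D hD => ?_, fun Xs hXs => ?_⟩
  · -- the hypersurface
    rw [hM, Scheme.IdealSheafData.comap_comp, hypSheaf, hypSheaf, hgΘ, ChartDictionary.comap_ofIdealTop_span_γ_symm, RingHom.coe_coe, hhyp]
  · -- the centre
    rw [hZ, Scheme.IdealSheafData.comap_comp]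
    congr 1
    rw [AffineCoordBlowup.𝓘Λ]
    exact (vanishingIdeal_comap_eq_of_preimage_eq (asIso gΘ) _ hpre).symm
  · -- the centre is still seen
    intro x hx
    have hgx : gΘ (inv gΘ x) = x := by rw [← Scheme.Hom.comp_apply, IsIso.inv_hom_id]; rfl
    have hx' : inv gΘ x ∈ (AffineCoordBlowup.CΛ 4 K (insert 0 (Fin.succ '' (T : Set (Fin 4)))) : Set (P 4 K)) := by
      rw [← hpre, Set.mem_preimage, hgx]
      exact hx
    obtain ⟨y, hy⟩ := hsee hx'
    refine ⟨y, ?_⟩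
    rw [Scheme.Hom.comp_apply, hy, hgx]
  · -- letters fixed by `τ`
    rw [hD, Scheme.IdealSheafData.comap_comp, hgΘ, ChartDictionary.comap_ofIdealTop_span_γ_symm, RingHom.coe_coe, hfix i c hi]
  · -- owned sets with deferral indices fixed by `τ`
    ext y
    simp only [Set.mem_preimage, Scheme.Hom.comp_apply, mem_ownedSetZ_iff]
    have h1 : gΘ (ψ y) ∈ (AffineCoordBlowup.CΛ 4 K (insert 0 (Fin.succ '' (T : Set (Fin 4)))) : Set (P 4 K)) ↔
        ψ y ∈ (AffineCoordBlowup.CΛ 4 K (insert 0 (Fin.succ '' (T : Set (Fin 4)))) : Set (P 4 K)) := by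
      rw [← Set.mem_preimage, hpre]
    have h2 : ∀ iv ∈ Xs, ((MvPolynomial.X iv.1.succ - C iv.2 : A 4 K) ∈ (gΘ (ψ y)).asIdeal ↔
        (MvPolynomial.X iv.1.succ - C iv.2 : A 4 K) ∈ (ψ y).asIdeal) := by
      intro iv hiv
      rw [hgΘ, Spec.map_apply, PrimeSpectrum.comap_asIdeal, Ideal.mem_comap, CommRingCat.hom_ofHom, RingHom.coe_coe]
      have h3 : Θ (MvPolynomial.X iv.1.succ - C iv.2) = MvPolynomial.X iv.1.succ - C iv.2 := by
        have h4 := hfix iv.1 (-iv.2) (hXs iv hiv)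
        rw [map_neg, ← sub_eq_add_neg] at h4
        exact h4
      rw [h3]
    rw [h1]
    exact and_congr_right fun _ => ⟨fun h iv hiv => (h2 iv hiv).mp (h iv hiv), fun h iv hiv => (h2 iv hiv).mpr (h iv hiv)⟩

end ShearReading

end Equimultiple

end Summit.ResolutionOfSingularities.ResolutionOfSingularities.Theorems.PIDim4

end
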